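import Mathlib
import HarnessLib
import Summits.ResolutionOfSingularities.ResolutionOfSingularities.Theorems.HomologicalConductorPersistenceKC3FrobeniusOrderBasis
import Summits.ResolutionOfSingularities.ResolutionOfSingularities.Theorems.HomologicalConductorPersistenceFrobeniusOrderLocal

/-!
# K-C3, object K4d (theorems): `W₀` is a free FROBENIUS order over `P₀ = k[a⁶,b³,c²]`, hence the
# all-levels device holds at `W₀` and at every localisation of it — no `hGor`, no named fact

Route `ResolutionOfSingularities/HomologicalConductor`, chain W4.4b, crux `Persistence`
(stmt-ResolutionOfSingularities-16484), KILL CANDIDATE K-C3 (res-L1-w44b-plan-1 K5 AMENDMENT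
2026-08-27T12:34:43Z (B): «hGor, F3, F4 STRUCK from KC3Facts … 037 TAKES K4d»).
[OURS · L1 w44b · res-D-pv-037 gen 9; AI-written and AI-reviewed only (weaker than expert review);
NOT a statement of the manuscript under study.]

* `boxMonomial_mul` — `mᵢ · mⱼ = a^{box i + box j}` in `W₀`;
* **`kc3τ_basis_mul_basisDual : kc3τ (kc3Basis i * kc3BasisDual j) = if i = j then 1 else 0`** — the
  Gram matrix of the Frobenius form `τ` = coefficient of `a⁵b²c` on the box basis against its reversal
  is the identity (res-D-pv-058 U15's hand table, kernel-checked: `box i + box (5 − j)` has box index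
  `5` iff `i = j`, and then equals `box 5` on the nose);
* instances: `Module.Finite ↥P₀ ↥W₀`, `Module.Free ↥P₀ ↥W₀` (`P₀ = kc3P k = k[a⁶,b³,c²] ⊆ W₀`);
* `projective_quotient_range_of_retraction` — cokernel of a split injection into a projective module is
  projective (the certificate shape suggested for K4e: an explicit retraction of `S₁ → S₃ ⊕ W⁵`);
* **`not_mem_cohomologyAnnihilator(OfDegree)_of_kc3Lattice`** — the all-levels device AT `W₀`:
  `L` finitely generated over `W₀` and projective over `P₀`, `¬ StablyAnnihilates W₀ x L` ⇒ `x ∉ caⁿ(W₀)`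
  for all `n`;
* **`not_mem_cohomologyAnnihilator(OfDegree)_of_kc3Lattice_baseChange` / `…_isLocalization`** — the
  same after any flat base change `W₀ → Λ'` (in particular a localisation, e.g. the bridge to
  `T₁ = loc O W`): `¬ StablyAnnihilates Λ' x (Λ' ⊗_{W₀} L) → x ∉ caⁿ(Λ')` for all `n` — THE K5 SOCKET
  replacing `hGor`: remaining inputs are the bridge (`IsLocalization`/flatness, res-D-pv-058 K4c /
  res-type-010), the lattice `L = X_b` with `Module.Projective P₀ X_b` (K4e) and the certificate (K4c).
-/

noncomputable section

-- single-problem summit: the doubled namespace component `ResolutionOfSingularities` is forced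
set_option linter.dupNamespace false

open MvPolynomial TensorProduct CategoryTheory Literature.RingTheory.CohomologyAnnihilator
open Summit.ResolutionOfSingularities.ResolutionOfSingularities.Theorems.NoZeno.SandwichCluster

universe u

namespace Summit.ResolutionOfSingularities.ResolutionOfSingularities.Theorems.HomologicalConductor.KC3FrobeniusOrder

open Summit.ResolutionOfSingularities.ResolutionOfSingularities.Theorems.HomologicalConductor.KC3Witness (e e_apply_zero e_apply_one e_apply_two e_add e_zero)
open Summit.ResolutionOfSingularities.ResolutionOfSingularities.Theorems.HomologicalConductor.FrobeniusOrderSyzygy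

variable {k : Type u} [Field k]

/-! ## The Gram matrix of `τ` on the box basis -/

/-- Products of box monomials: `mᵢ · mⱼ = a^{box i + box j}`. [OURS · bookkeeping] -/
theorem boxMonomial_mul (i j : Fin 6) : boxMonomial k i * boxMonomial k j =
    ⟨monomial (box i + box j) 1,
      monomial_mem_kc3W (by rw [wt_add]; exact dvd_add (wt_box_dvd i) (wt_box_dvd j)) 1⟩ := by
  apply Subtype.ext
  change monomial (box i) (1 : k) * monomial (box j) 1 = monomial (box i + box j) 1
  rw [monomial_mul, mul_one]

/-- The box index of `box i + box (5 − j)` is `5` iff `i = j`. [OURS · bookkeeping] -/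
theorem boxIdx_box_add_box_rev (i j : Fin 6) : boxIdx (box i + box (Fin.rev j)) = 5 ↔ i = j := by
  fin_cases i <;> fin_cases j <;> simp [boxIdx, box, e, Fin.rev, Fin.ext_iff]

/-- `box i + box (5 − i) = box 5 = (5,2,1)` on the nose (the three antidiagonal products
`1·a⁵b²c`, `a⁴b·abc`, `a²b²·a³c` all equal `a⁵b²c`). [OURS · bookkeeping] -/
theorem box_add_box_rev (i : Fin 6) : box i + box (Fin.rev i) = box 5 := by
  ext x; fin_cases i <;> fin_cases x <;> simp [box, e, Fin.rev]

/-- **The Gram identity**: `τ(mᵢ · m∨ⱼ) = δᵢⱼ` for the box basis `m`, its reversal `m∨` and the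
Frobenius form `τ` = `P₀`-coefficient of `a⁵b²c` — `W₀` is a free FROBENIUS (indeed symmetric) order
over `P₀ = k[a⁶,b³,c²]`. [OURS · L1 w44b; res-D-pv-058 U15's table, kernel-checked] -/
theorem kc3τ_basis_mul_basisDual (i j : Fin 6) :
    kc3τ k (kc3Basis k i * kc3BasisDual k j) = if i = j then 1 else 0 := by
  rw [kc3Basis_apply, kc3BasisDual_apply, boxMonomial_mul,
    kc3τ_monomial (by rw [wt_add]; exact dvd_add (wt_box_dvd _) (wt_box_dvd _))]
  by_cases h : i = j
  · subst h
    have hq : quo (box i + box (Fin.rev i)) = 0 := by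
      rw [box_add_box_rev, show box (5 : Fin 6) = box 5 + sc 0 by
        ext x; fin_cases x <;> simp [sc, e], quo_box_add_sc]
    rw [if_pos ((boxIdx_box_add_box_rev i i).mpr rfl), if_pos rfl, hq, scMonomial_zero_one]
  · rw [if_neg (fun h' => h ((boxIdx_box_add_box_rev i j).mp h')), if_neg h]

/-! ## `W₀` is finite free over `P₀` -/

/-- `W₀` is a finitely generated `P₀`-module. [OURS · L1 w44b] -/
instance kc3W.moduleFinite : Module.Finite ↥(kc3P k) ↥(kc3W k) :=
  Module.Finite.of_basis (kc3Basis k)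

/-- `W₀` is a free `P₀`-module. [OURS · L1 w44b] -/
instance kc3W.moduleFree : Module.Free ↥(kc3P k) ↥(kc3W k) :=
  Module.Free.of_basis (kc3Basis k)

/-! ## A convenience for K4e: cokernels of split injections are projective -/

/-- **Cokernel of a split injection into a projective module is projective**: if `f : M → N` admits a
retraction `r` (`r ∘ f = id`) and `N` is projective then `N ⧸ range f` is a direct summand of `N`
(section `[n] ↦ n − f (r n)`), hence projective.  The intended use (K4e): `X_b = coker(S₁ → S₃ ⊕ W⁵)`
over `P₀` with an explicit `6 × 36` retraction matrix. [folklore] -/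
theorem projective_quotient_range_of_retraction {R : Type*} [CommRing R] {M N : Type*}
    [AddCommGroup M] [Module R M] [AddCommGroup N] [Module R N] [Module.Projective R N]
    (f : M →ₗ[R] N) (r : N →ₗ[R] M) (h : r ∘ₗ f = LinearMap.id) :
    Module.Projective R (N ⧸ LinearMap.range f) := by
  have hsec : LinearMap.range f ≤ LinearMap.ker (LinearMap.id - f ∘ₗ r) := by
    rintro _ ⟨m, rfl⟩
    have := LinearMap.congr_fun h m
    simp only [LinearMap.coe_comp, Function.comp_apply, LinearMap.id_apply] at this
    simp only [LinearMap.mem_ker, LinearMap.sub_apply, LinearMap.id_apply, LinearMap.coe_comp,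
      Function.comp_apply, this, sub_self]
  refine Module.Projective.of_split ((LinearMap.range f).liftQ _ hsec) (LinearMap.range f).mkQ ?_
  apply LinearMap.ext
  intro x
  induction x using Submodule.Quotient.induction_on with
  | H n =>
    simp only [LinearMap.coe_comp, Function.comp_apply, Submodule.mkQ_apply, Submodule.liftQ_apply,
      LinearMap.sub_apply, LinearMap.id_apply, map_sub]
    rw [sub_eq_self, Submodule.Quotient.mk_eq_zero]
    exact LinearMap.mem_range_self f _

/-! ## The all-levels device at `W₀` and at its localisations (the K5 socket) -/

section Device

variable (L : Type u) [AddCommGroup L] [Module ↥(kc3W k) L] [Module ↥(kc3P k) L]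
  [IsScalarTower ↥(kc3P k) ↥(kc3W k) L]

/-- **All levels at `W₀`, levelled**: for a finitely generated `W₀`-module `L` that is projective over
`P₀ = k[a⁶,b³,c²]`, if `x • 𝟙 L` does not factor through a finitely generated projective `W₀`-module
then `x ∉ caⁿ(W₀)` for every `n`. [OURS · L1 w44b] -/
theorem not_mem_cohomologyAnnihilatorOfDegree_of_kc3Lattice [Module.Finite ↥(kc3W k) L]
    [Module.Projective ↥(kc3P k) L] {x : ↥(kc3W k)}
    (hx : ¬ StablyAnnihilates ↥(kc3W k) x (ModuleCat.of ↥(kc3W k) L)) (n : ℕ) :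
    x ∉ cohomologyAnnihilatorOfDegree ↥(kc3W k) n :=
  not_mem_cohomologyAnnihilatorOfDegree_of_frobeniusOrder_basis L (kc3Basis k) (kc3BasisDual k)
    kc3τ_basis_mul_basisDual hx n

/-- **All levels at `W₀`**: under the same hypotheses `x ∉ ca(W₀)`. [OURS · L1 w44b] -/
theorem not_mem_cohomologyAnnihilator_of_kc3Lattice [Module.Finite ↥(kc3W k) L]
    [Module.Projective ↥(kc3P k) L] {x : ↥(kc3W k)}
    (hx : ¬ StablyAnnihilates ↥(kc3W k) x (ModuleCat.of ↥(kc3W k) L)) :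
    x ∉ cohomologyAnnihilator ↥(kc3W k) :=
  not_mem_cohomologyAnnihilator_of_frobeniusOrder_basis L (kc3Basis k) (kc3BasisDual k)
    kc3τ_basis_mul_basisDual hx

variable (Λ' : Type u) [CommRing Λ'] [Algebra ↥(kc3W k) Λ']

/-- **THE K5 SOCKET (levelled)** — all levels after a flat base change `W₀ → Λ'` (e.g. the bridge to
`T₁ = loc O W`): `Λ'` flat and noetherian over `W₀`, `L` finitely generated over `W₀` and projective over
`P₀`; if `x ∈ Λ'` does NOT stably annihilate `Λ' ⊗_{W₀} L` then `x ∉ caⁿ(Λ')` for every `n`.  With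
`L = X_b` (K4e) and `hx` = K4c this is «`a⁶ ∉ caⁿ(T₁)` for all `n`» without `hGor`. [OURS · L1 w44b] -/
theorem not_mem_cohomologyAnnihilatorOfDegree_of_kc3Lattice_baseChange [Module.Flat ↥(kc3W k) Λ']
    [IsNoetherianRing Λ'] [Module.Finite ↥(kc3W k) L] [Module.Projective ↥(kc3P k) L]
    {x : Λ'} (hx : ¬ StablyAnnihilates Λ' x (ModuleCat.of Λ' (Λ' ⊗[↥(kc3W k)] L))) (n : ℕ) :
    x ∉ cohomologyAnnihilatorOfDegree Λ' n :=
  not_mem_cohomologyAnnihilatorOfDegree_of_frobeniusOrder_baseChange Λ' L (kc3Basis k)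
    (kc3BasisDual k) kc3τ_basis_mul_basisDual hx n

/-- **THE K5 SOCKET** (`ca` form): under the same hypotheses `x ∉ ca(Λ')`. [OURS · L1 w44b] -/
theorem not_mem_cohomologyAnnihilator_of_kc3Lattice_baseChange [Module.Flat ↥(kc3W k) Λ']
    [IsNoetherianRing Λ'] [Module.Finite ↥(kc3W k) L] [Module.Projective ↥(kc3P k) L]
    {x : Λ'} (hx : ¬ StablyAnnihilates Λ' x (ModuleCat.of Λ' (Λ' ⊗[↥(kc3W k)] L))) :
    x ∉ cohomologyAnnihilator Λ' :=
  not_mem_cohomologyAnnihilator_of_frobeniusOrder_baseChange Λ' L (kc3Basis k) (kc3BasisDual k)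
    kc3τ_basis_mul_basisDual hx

/-- **THE K5 SOCKET, localised form (levelled)**: `Λ'` a localisation of `W₀` (hence flat),
noetherian: `¬ StablyAnnihilates Λ' x (Λ' ⊗_{W₀} L) → x ∉ caⁿ(Λ')` for every `n`. [OURS · L1 w44b] -/
theorem not_mem_cohomologyAnnihilatorOfDegree_of_kc3Lattice_isLocalization (S : Submonoid ↥(kc3W k))
    [IsLocalization S Λ'] [IsNoetherianRing Λ'] [Module.Finite ↥(kc3W k) L]
    [Module.Projective ↥(kc3P k) L] {x : Λ'}
    (hx : ¬ StablyAnnihilates Λ' x (ModuleCat.of Λ' (Λ' ⊗[↥(kc3W k)] L))) (n : ℕ) :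
    x ∉ cohomologyAnnihilatorOfDegree Λ' n :=
  not_mem_cohomologyAnnihilatorOfDegree_of_frobeniusOrder_isLocalization Λ' L S (kc3Basis k)
    (kc3BasisDual k) kc3τ_basis_mul_basisDual hx n

/-- **THE K5 SOCKET, localised form** (`ca`): under the same hypotheses `x ∉ ca(Λ')`. [OURS · L1 w44b] -/
theorem not_mem_cohomologyAnnihilator_of_kc3Lattice_isLocalization (S : Submonoid ↥(kc3W k))
    [IsLocalization S Λ'] [IsNoetherianRing Λ'] [Module.Finite ↥(kc3W k) L]
    [Module.Projective ↥(kc3P k) L] {x : Λ'}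
    (hx : ¬ StablyAnnihilates Λ' x (ModuleCat.of Λ' (Λ' ⊗[↥(kc3W k)] L))) :
    x ∉ cohomologyAnnihilator Λ' :=
  not_mem_cohomologyAnnihilator_of_frobeniusOrder_isLocalization Λ' L S (kc3Basis k)
    (kc3BasisDual k) kc3τ_basis_mul_basisDual hx

end Device

end Summit.ResolutionOfSingularities.ResolutionOfSingularities.Theorems.HomologicalConductor.KC3FrobeniusOrder

end
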